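import Summits.RiemannHypothesis.RiemannHypothesis.Theorems.Splittings.ScrewNullCombDirichlet
import Summits.RiemannHypothesis.RiemannHypothesis.Theorems.Splittings.ScrewNullCombLandau
import Literature.NumberTheory.LFunctions.ZetaZeroPowerSums

/-!
# Splittings — SCREW NULL COMBINATIONS VIII: uniqueness for node identities over the zeros; `R_z(ρ−½) = 0` at EVERY zero

Cell rh-split (brief sha16 f79c5f09d8bcb036), seat rh-split-typer-2 g3 (prover; own initiative «NNC WITHOUT FOZ» on the cross/screw
column, lead GO HOME/INBOX.md 03:41:07Z, checkpoints 03:51Z/03:58Z/04:09Z/04:2xZ): the series SCREW NULL COMBINATIONS I–VI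
(`ScrewNullCombUniqueness` … `ScrewNullCombination`) proved NNC = «no non-zero finite real combination
`t ↦ Σ_{j<n} z_j G_g(t, log(j+2))` of sections of Suzuki's screw kernel vanishes at every node `log(i+2)`» GIVEN finitely many
off-line zeros (`nnc_of_finite_offline`).  Parts VII–IX remove that hypothesis: NNC holds outright (`ScrewNullCombUnconditional.nnc`).
This file is part VIII: the uniqueness theorem and its application.  `coeff_eq_zero_of_nodes`: if
`Σ_ρ ‖a ρ‖(2+|Im ρ|)^{3/4} < ∞` and `Σ_ρ a(ρ) m^{ρ−½} = A₀` for every integer `m ≥ 1`, then `a(ρ) = 0` for EVERY non-trivial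
zero — assuming `a ρ₀ ≠ 0`, take the zero `ρ*` of maximal real part among the finitely many with `Im ρ = Im ρ₀` and `a ρ ≠ 0`,
continue `Σ_ρ a(ρ)ζ(s−(ρ−½)) = A₀ζ(s)` (part VII) to the box `{Re ρ* + ½ < Re s < 4, |Im s − Im ρ₀| < η}` by the identity theorem,
and let `s → ρ* + ½` along the ordinate: every other term and `A₀ζ(s)` stay bounded while `a(ρ*)ζ(1 + x)` blows up.
Application (`R_eq_zero_of_nodes`): for a real node-null vector `z` (`Σ_j G_g(log(i+2), log(j+2)) z_j = 0` for all `i`) the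
coefficients `a(ρ) = m(ρ)(ρ−½)^{-2} R_z(ρ−½)`, `R_z(w) = Σ_j z_j(1 − (j+2)^{−w})`, satisfy the weight condition (`weight_le` and
the tree's `ZetaZeroSum.summable_zeroOrder_div_norm_sub_half_rpow` at `σ = 5/4, 2`) and the node equations (part III's
`hasSum_nodeComb` at `t = log(m+1)`), hence `R_z(ρ−½) = 0` at EVERY non-trivial zero.  [new]

HONEST LABEL: RH-free and FOZ-free analysis of Suzuki's screw kernel at the integer nodes (inputs: the tree's ζ-growth bounds,
`riemannZeta_residue_one`, Suzuki's series (1.9) as landed in part III, Landau–Gonek and Riemann–von Mangoldt as landed in part V);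
it concerns the CONDITIONAL bridge bookkeeping of cell rh-split («SPLITTING SEARCH over kernel-typed RH-EQUIVALENCES; a splitting
A ∧ B ⟹ RH is CONDITIONAL bookkeeping unless A and B are both proved») and nothing here bears on the truth of RH.
-/

set_option linter.dupNamespace false

noncomputable section

namespace Summit.RiemannHypothesis.RiemannHypothesis.Theorems.Splittings.ScrewNullComb

open Filter Topology Complex Finset Set
open Literature.NumberTheory.LFunctions

/-- **Uniqueness for node identities over the zeros** (assembly of D1–D4): if
`Σ_ρ ‖a(ρ)‖(2+|Im ρ|)^{3/4} < ∞` and `Σ_ρ a(ρ) m^{ρ−½} = A₀` for every `m ≥ 1`, then `a(ρ) = 0` for EVERY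
non-trivial zero `ρ`. [new] -/
theorem coeff_eq_zero_of_nodes (a : ZetaZeros.riemannZetaNontrivialZeros → ℂ) (A₀ : ℂ)
    (hA : Summable fun ρ ↦ ‖a ρ‖ * (2 + |(ρ : ℂ).im|) ^ (3 / 4 : ℝ))
    (hnode : ∀ n : ℕ, HasSum (fun ρ ↦ a ρ * ((n + 1 : ℕ) : ℂ) ^ ((ρ : ℂ) - 1 / 2)) A₀)
    (ρ₀ : ZetaZeros.riemannZetaNontrivialZeros) : a ρ₀ = 0 := by
  classical
  by_contra hne0
  -- plain summability of `a`
  have ha : Summable fun ρ ↦ ‖a ρ‖ := by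
    refine .of_nonneg_of_le (fun _ ↦ norm_nonneg _) (fun ρ ↦ ?_) hA
    have : (1 : ℝ) ≤ (2 + |(ρ : ℂ).im|) ^ (3 / 4 : ℝ) := Real.one_le_rpow (by linarith [abs_nonneg ((ρ:ℂ).im)]) (by norm_num)
    nlinarith [norm_nonneg (a ρ)]
  set γ₀ : ℝ := (ρ₀ : ℂ).im with hγ₀
  have hγ₀ne : γ₀ ≠ 0 := ZetaZeros.riemannZetaNontrivialZeros.im_ne_zero ρ₀.2
  -- the near zeros and the rightmost bad zero on the ordinate `γ₀`
  set near : Finset ZetaZeros.riemannZetaNontrivialZeros := (near_finite γ₀).toFinset with hnear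
  have hmem_near : ∀ ρ, ρ ∈ near ↔ |(ρ : ℂ).im - γ₀| < 4 := fun ρ ↦ by
    rw [hnear, Set.Finite.mem_toFinset]; rfl
  have hfar : ∀ ρ, ρ ∉ near → 4 ≤ |(ρ : ℂ).im - γ₀| := fun ρ h ↦ by
    rw [hmem_near] at h; exact not_lt.1 h
  set P : Finset ZetaZeros.riemannZetaNontrivialZeros := near.filter fun ρ ↦ (ρ : ℂ).im = γ₀ ∧ a ρ ≠ 0 with hP
  have hρ₀P : ρ₀ ∈ P := Finset.mem_filter.2 ⟨(hmem_near ρ₀).2 (by simp [hγ₀]), rfl, hne0⟩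
  obtain ⟨ρs, hρsP, hmax⟩ := P.exists_max_image (fun ρ ↦ (ρ : ℂ).re) ⟨ρ₀, hρ₀P⟩
  have hρs := Finset.mem_filter.1 hρsP
  have hβs : 0 < (ρs : ℂ).re := ZetaZeros.riemannZetaNontrivialZeros.re_pos ρs.2
  have hβs1 : (ρs : ℂ).re < 1 := ZetaZeros.riemannZetaNontrivialZeros.re_lt_one ρs.2
  set σ₁ : ℝ := (ρs : ℂ).re + 1 / 2 with hσ₁
  have hσ₁1 : 1 / 2 ≤ σ₁ := by rw [hσ₁]; linarith
  have hσ₁2 : σ₁ < 3 / 2 := by rw [hσ₁]; linarith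
  -- the gap `η` (also `≤ |γ₀|/2`, which keeps the pole of `ζ(s)` itself out of the box)
  have hγ₀pos : 0 < |γ₀| := abs_pos.2 hγ₀ne
  obtain ⟨η, hη0, hη1, hηγ, hηgap⟩ : ∃ η : ℝ, 0 < η ∧ η ≤ 1 ∧ η ≤ |γ₀| / 2 ∧
      ∀ ρ ∈ near, (ρ : ℂ).im ≠ γ₀ → η < |(ρ : ℂ).im - γ₀| := by
    set near' := near.filter (fun ρ : ZetaZeros.riemannZetaNontrivialZeros ↦ (ρ : ℂ).im ≠ γ₀) with hnear'
    set η₀ : ℝ := min 1 (|γ₀| / 2) with hη₀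
    have hη₀0 : 0 < η₀ := lt_min one_pos (by linarith)
    by_cases hne : near'.Nonempty
    · obtain ⟨ρm, hρm, hmin⟩ := near'.exists_min_image (fun ρ ↦ |(ρ : ℂ).im - γ₀|) hne
      have hpos : 0 < |(ρm : ℂ).im - γ₀| := abs_pos.2 (sub_ne_zero.2 (Finset.mem_filter.1 hρm).2)
      refine ⟨min η₀ (|(ρm : ℂ).im - γ₀| / 2), lt_min hη₀0 (by linarith), (min_le_left _ _).trans (min_le_left _ _),
        (min_le_left _ _).trans (min_le_right _ _), fun ρ hρ hγ ↦ ?_⟩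
      have := hmin ρ (Finset.mem_filter.2 ⟨hρ, hγ⟩)
      exact lt_of_le_of_lt (min_le_right _ _) (by linarith)
    · refine ⟨η₀, hη₀0, min_le_left _ _, min_le_right _ _, fun ρ hρ hγ ↦ ?_⟩
      exact absurd ⟨ρ, Finset.mem_filter.2 ⟨hρ, hγ⟩⟩ hne
  -- the box
  set U : Set ℂ := {s : ℂ | σ₁ < s.re ∧ s.re < 4 ∧ |s.im - γ₀| < η} with hU
  have hUopen : IsOpen U := by
    have h1 : IsOpen {s : ℂ | σ₁ < s.re} := isOpen_lt continuous_const Complex.continuous_re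
    have h2 : IsOpen {s : ℂ | s.re < 4} := isOpen_lt Complex.continuous_re continuous_const
    have h3 : IsOpen {s : ℂ | |s.im - γ₀| < η} :=
      isOpen_lt (continuous_abs.comp (Complex.continuous_im.sub continuous_const)) continuous_const
    have e : U = {s : ℂ | σ₁ < s.re} ∩ ({s : ℂ | s.re < 4} ∩ {s : ℂ | |s.im - γ₀| < η}) := by
      ext s; simp [hU, Set.mem_inter_iff]
    rw [e]; exact h1.inter (h2.inter h3)
  have hUconv : Convex ℝ U := by
    have e : U = {s : ℂ | σ₁ < s.re} ∩ ({s : ℂ | s.re < 4} ∩ ({s : ℂ | s.im < γ₀ + η} ∩ {s : ℂ | γ₀ - η < s.im})) := by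
      ext s; simp only [hU, Set.mem_setOf_eq, Set.mem_inter_iff, abs_lt]; constructor
      · rintro ⟨h1, h2, h3, h4⟩; exact ⟨h1, h2, by linarith, by linarith⟩
      · rintro ⟨h1, h2, h3, h4⟩; exact ⟨h1, h2, by linarith, by linarith⟩
    rw [e]
    exact (convex_halfSpace_re_gt σ₁).inter ((convex_halfSpace_re_lt 4).inter
      ((convex_halfSpace_im_lt _).inter (convex_halfSpace_im_gt _)))
  -- poles of the near terms avoid `U`, and avoid the segment `[σ₁, σ₁ + 1/2] + iγ₀` except for `ρs`
  have hpoleU : ∀ ρ ∈ near, a ρ ≠ 0 → ∀ s ∈ U, s - ((ρ : ℂ) - 1 / 2) ≠ 1 := by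
    intro ρ hρ haρ s hs h
    have hre : s.re = (ρ : ℂ).re + 1 / 2 := by
      have := congrArg Complex.re h; simp at this; linarith
    have him : s.im = (ρ : ℂ).im := by
      have := congrArg Complex.im h; simp at this; linarith
    by_cases hγ : (ρ : ℂ).im = γ₀
    · have hρP : ρ ∈ P := Finset.mem_filter.2 ⟨hρ, hγ, haρ⟩
      have := hmax ρ hρP
      have := hs.1
      rw [hσ₁] at this; linarith
    · have := hηgap ρ hρ hγ
      have h2 := hs.2.2
      rw [him] at h2; linarith
  -- the two pieces of `Z`
  set Gfar : ℂ → ℂ := fun s ↦ ∑' ρ : {ρ // ρ ∉ near}, a ρ * riemannZeta (s - ((ρ : ℂ) - 1 / 2)) with hGfar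
  set Gnear : ℂ → ℂ := fun s ↦ ∑ ρ ∈ near, a ρ * riemannZeta (s - ((ρ : ℂ) - 1 / 2)) with hGnear
  obtain ⟨hfar_diff, hfar_bd⟩ := differentiableOn_far a hA hσ₁1 hη1 near hfar
  have hnear_diff : DifferentiableOn ℂ Gnear U := by
    rw [hGnear]
    refine DifferentiableOn.fun_sum fun ρ hρ ↦ ?_
    exact differentiableOn_term (a ρ) (ρ : ℂ) (hpoleU ρ hρ)
  have hZdiff : DifferentiableOn ℂ (fun s ↦ Gnear s + Gfar s) U := hnear_diff.add hfar_diff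
  have hζdiff : DifferentiableOn ℂ (fun s ↦ A₀ * riemannZeta s) U := by
    intro s hs
    have hs1 : s ≠ 1 := by
      intro h; have := hs.2.2; rw [h, Complex.one_im, zero_sub, abs_neg] at this; linarith
    exact ((differentiableAt_riemannZeta hs1).const_mul A₀).differentiableWithinAt
  -- agreement on `U ∩ {Re s > 3/2}`
  have hagree : ∀ s ∈ U, 3 / 2 < s.re → Gnear s + Gfar s = A₀ * riemannZeta s := by
    intro s _ hs
    have h := hasSum_dirichlet a A₀ ha hnode hs
    rw [hGnear, hGfar]
    simp only
    rw [h.summable.sum_add_tsum_subtype_compl near, h.tsum_eq]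
  -- identity theorem on the convex box
  set z₀ : ℂ := ⟨2, γ₀⟩ with hz₀
  have hz₀U : z₀ ∈ U := by
    refine ⟨by simp [hz₀]; linarith, by simp [hz₀]; norm_num, by simp [hz₀, hη0]⟩
  have hEq : Set.EqOn (fun s ↦ Gnear s + Gfar s) (fun s ↦ A₀ * riemannZeta s) U := by
    refine (hZdiff.analyticOnNhd hUopen).eqOn_of_preconnected_of_eventuallyEq (hζdiff.analyticOnNhd hUopen)
      hUconv.isPreconnected hz₀U ?_
    have hV : IsOpen (U ∩ {s : ℂ | 3 / 2 < s.re}) := hUopen.inter (isOpen_lt continuous_const Complex.continuous_re)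
    have hz₀V : z₀ ∈ U ∩ {s : ℂ | 3 / 2 < s.re} := ⟨hz₀U, by simp [hz₀]; norm_num⟩
    filter_upwards [hV.mem_nhds hz₀V] with s hs
    exact hagree s hs.1 hs.2
  -- the segment `s_x = (σ₁ + x) + iγ₀`, `x ∈ [0, 1/2]`
  set seg : ℝ → ℂ := fun x ↦ ((σ₁ + x : ℝ) : ℂ) + (γ₀ : ℂ) * I with hseg
  have hseg_re : ∀ x, (seg x).re = σ₁ + x := fun x ↦ by simp [hseg]
  have hseg_im : ∀ x, (seg x).im = γ₀ := fun x ↦ by simp [hseg]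
  have hsegU : ∀ x : ℝ, 0 < x → x < 1 / 2 → seg x ∈ U := fun x hx1 hx2 ↦
    ⟨by rw [hseg_re]; linarith, by rw [hseg_re]; linarith, by rw [hseg_im]; simp [hη0]⟩
  have hseg_cont : Continuous seg := by rw [hseg]; fun_prop
  set K : Set ℂ := seg '' Set.Icc 0 (1 / 2) with hK
  have hKc : IsCompact K := isCompact_Icc.image hseg_cont
  have hK1 : ∀ s ∈ K, s ≠ 1 := by
    rintro s ⟨x, -, rfl⟩ h
    have := congrArg Complex.im h
    rw [hseg_im] at this
    simp at this
    exact hγ₀ne this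
  have hKpole : ∀ ρ ∈ near.erase ρs, a ρ ≠ 0 → ∀ s ∈ K, s - ((ρ : ℂ) - 1 / 2) ≠ 1 := by
    rintro ρ hρ haρ s ⟨x, hx, rfl⟩ h
    obtain ⟨hne, hρn⟩ := Finset.mem_erase.1 hρ
    have hre : σ₁ + x = (ρ : ℂ).re + 1 / 2 := by
      have := congrArg Complex.re h; rw [Complex.sub_re, hseg_re] at this; simp at this; linarith
    have him : γ₀ = (ρ : ℂ).im := by
      have := congrArg Complex.im h; rw [Complex.sub_im, hseg_im] at this; simp at this; linarith
    have hρP : ρ ∈ P := Finset.mem_filter.2 ⟨hρn, him.symm, haρ⟩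
    have h1 := hmax ρ hρP
    have h2 : (ρs : ℂ).re ≤ (ρ : ℂ).re := by rw [hσ₁] at hre; linarith [hx.1]
    exact hne (Subtype.ext (Complex.ext (le_antisymm h1 h2) (by rw [← him, hρs.2.1])))
  -- bounds on the segment
  have hcont_near : ContinuousOn
      (fun s ↦ ∑ ρ ∈ near.erase ρs, a ρ * riemannZeta (s - ((ρ : ℂ) - 1 / 2))) K :=
    (DifferentiableOn.fun_sum fun ρ hρ ↦ differentiableOn_term (a ρ) (ρ : ℂ) (hKpole ρ hρ)).continuousOn
  obtain ⟨B₁, hB₁⟩ := hKc.exists_bound_of_continuousOn hcont_near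
  have hcont_ζ : ContinuousOn (fun s ↦ A₀ * riemannZeta s) K := by
    refine DifferentiableOn.continuousOn (𝕜 := ℂ) fun s hs ↦ ?_
    exact ((differentiableAt_riemannZeta (hK1 s hs)).const_mul A₀).differentiableWithinAt
  obtain ⟨B₂, hB₂⟩ := hKc.exists_bound_of_continuousOn hcont_ζ
  set B₃ : ℝ := ∑' ρ : {ρ // ρ ∉ near}, ‖a (ρ : ZetaZeros.riemannZetaNontrivialZeros)‖ *
      (84 * ((1 + |γ₀|) ^ (3 / 4 : ℝ) * (2 + |((ρ : ZetaZeros.riemannZetaNontrivialZeros) : ℂ).im|) ^ (3 / 4 : ℝ)))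
    with hB₃
  have hmain : ∀ x : ℝ, 0 < x → x < 1 / 2 → ‖a ρs * riemannZeta (1 + x)‖ ≤ B₂ + B₁ + B₃ := by
    intro x hx1 hx2
    have hsU := hsegU x hx1 hx2
    have hsK : seg x ∈ K := ⟨x, ⟨hx1.le, hx2.le⟩, rfl⟩
    have hEqx := hEq hsU
    simp only at hEqx
    have hsplit : Gnear (seg x) = a ρs * riemannZeta (seg x - ((ρs : ℂ) - 1 / 2)) +
        ∑ ρ ∈ near.erase ρs, a ρ * riemannZeta (seg x - ((ρ : ℂ) - 1 / 2)) := by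
      rw [hGnear]; exact (Finset.add_sum_erase near _ hρs.1).symm
    have hshift : seg x - ((ρs : ℂ) - 1 / 2) = 1 + x := by
      apply Complex.ext
      · rw [Complex.sub_re, hseg_re]; simp [hσ₁]; ring
      · rw [Complex.sub_im, hseg_im]; simp [hρs.2.1]
    have hfarx := hfar_bd (seg x) (by rw [hseg_re]; linarith) (by rw [hseg_im]; simp [hη0])
    have e : a ρs * riemannZeta (1 + x) = A₀ * riemannZeta (seg x) -
        (∑ ρ ∈ near.erase ρs, a ρ * riemannZeta (seg x - ((ρ : ℂ) - 1 / 2))) - Gfar (seg x) := by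
      rw [← hEqx, hsplit, hshift]; ring
    rw [e]
    have h1 := hB₂ _ hsK
    have h2 := hB₁ _ hsK
    calc ‖A₀ * riemannZeta (seg x) - ∑ ρ ∈ near.erase ρs, a ρ * riemannZeta (seg x - ((ρ : ℂ) - 1 / 2)) - Gfar (seg x)‖
        ≤ ‖A₀ * riemannZeta (seg x)‖ + ‖∑ ρ ∈ near.erase ρs, a ρ * riemannZeta (seg x - ((ρ : ℂ) - 1 / 2))‖
            + ‖Gfar (seg x)‖ := by
          have := norm_sub_le (A₀ * riemannZeta (seg x) - ∑ ρ ∈ near.erase ρs, a ρ * riemannZeta (seg x - ((ρ : ℂ) - 1 / 2)))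
            (Gfar (seg x))
          have := norm_sub_le (A₀ * riemannZeta (seg x)) (∑ ρ ∈ near.erase ρs, a ρ * riemannZeta (seg x - ((ρ : ℂ) - 1 / 2)))
          linarith
      _ ≤ B₂ + B₁ + B₃ := by rw [hGfar, hB₃]; linarith [hfarx]
  -- conclusion
  exact hρs.2.2 (eq_zero_of_bounded_mul_zeta (by norm_num : (0 : ℝ) < 1 / 2) hmain)

/-- The weight estimate: `m(ρ)‖ρ−½‖^{-2}(2+|Im ρ|)^{3/4} ≤ 6·(m/‖ρ−½‖^{5/4} + m/‖ρ−½‖^2)`. [folklore] -/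
theorem weight_le (ρ : ZetaZeros.riemannZetaNontrivialZeros) :
    (riemannZetaZeroOrder (ρ : ℂ) : ℝ) / ‖(ρ : ℂ) - 1 / 2‖ ^ 2 * (2 + |(ρ : ℂ).im|) ^ (3 / 4 : ℝ) ≤
      6 * ((riemannZetaZeroOrder (ρ : ℂ) : ℝ) / ‖(ρ : ℂ) - 1 / 2‖ ^ (5 / 4 : ℝ) +
        (riemannZetaZeroOrder (ρ : ℂ) : ℝ) / ‖(ρ : ℂ) - 1 / 2‖ ^ (2 : ℝ)) := by
  set w : ℂ := (ρ : ℂ) - 1 / 2 with hw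
  have hw0 : 0 < ‖w‖ := norm_pos_iff.2 (sub_half_ne_zero ρ)
  have hm : (0 : ℝ) ≤ riemannZetaZeroOrder (ρ : ℂ) := by exact_mod_cast (zeroOrder_pos ρ).le
  have hγ : |(ρ : ℂ).im| ≤ ‖w‖ := by
    have : w.im = (ρ : ℂ).im := by simp [hw]
    rw [← this]; exact Complex.abs_im_le_norm w
  have h2 : ‖w‖ ^ (2 : ℝ) = ‖w‖ ^ 2 := Real.rpow_two _
  have hA : 0 ≤ (riemannZetaZeroOrder (ρ : ℂ) : ℝ) / ‖w‖ ^ (5 / 4 : ℝ) := by positivity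
  have hB : 0 ≤ (riemannZetaZeroOrder (ρ : ℂ) : ℝ) / ‖w‖ ^ (2 : ℝ) := by positivity
  rcases le_or_gt 1 ‖w‖ with h1 | h1
  · -- `‖w‖ ≥ 1`: `(2+|γ|)^{3/4} ≤ (3‖w‖)^{3/4} ≤ 3 ‖w‖^{3/4}`
    have hle : (2 + |(ρ : ℂ).im|) ^ (3 / 4 : ℝ) ≤ 3 * ‖w‖ ^ (3 / 4 : ℝ) := by
      have h3 : 2 + |(ρ : ℂ).im| ≤ 3 * ‖w‖ := by linarith
      calc (2 + |(ρ : ℂ).im|) ^ (3 / 4 : ℝ) ≤ (3 * ‖w‖) ^ (3 / 4 : ℝ) :=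
            Real.rpow_le_rpow (by positivity) h3 (by norm_num)
        _ = (3 : ℝ) ^ (3 / 4 : ℝ) * ‖w‖ ^ (3 / 4 : ℝ) := Real.mul_rpow (by norm_num) hw0.le
        _ ≤ 3 * ‖w‖ ^ (3 / 4 : ℝ) := by
            gcongr
            calc (3 : ℝ) ^ (3 / 4 : ℝ) ≤ (3 : ℝ) ^ (1 : ℝ) :=
                  Real.rpow_le_rpow_of_exponent_le (by norm_num) (by norm_num)
              _ = 3 := Real.rpow_one 3
    have hkey : (riemannZetaZeroOrder (ρ : ℂ) : ℝ) / ‖w‖ ^ 2 * (3 * ‖w‖ ^ (3 / 4 : ℝ)) =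
        3 * ((riemannZetaZeroOrder (ρ : ℂ) : ℝ) / ‖w‖ ^ (5 / 4 : ℝ)) := by
      have e : ‖w‖ ^ 2 = ‖w‖ ^ (5 / 4 : ℝ) * ‖w‖ ^ (3 / 4 : ℝ) := by
        rw [← Real.rpow_add hw0]; norm_num
      rw [e]
      field_simp
    calc (riemannZetaZeroOrder (ρ : ℂ) : ℝ) / ‖w‖ ^ 2 * (2 + |(ρ : ℂ).im|) ^ (3 / 4 : ℝ)
        ≤ (riemannZetaZeroOrder (ρ : ℂ) : ℝ) / ‖w‖ ^ 2 * (3 * ‖w‖ ^ (3 / 4 : ℝ)) := by gcongr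
      _ = 3 * ((riemannZetaZeroOrder (ρ : ℂ) : ℝ) / ‖w‖ ^ (5 / 4 : ℝ)) := hkey
      _ ≤ _ := by nlinarith
  · -- `‖w‖ < 1`: `(2+|γ|)^{3/4} ≤ 3`
    have hle : (2 + |(ρ : ℂ).im|) ^ (3 / 4 : ℝ) ≤ 3 := by
      have h3 : 2 + |(ρ : ℂ).im| ≤ 3 := by linarith
      calc (2 + |(ρ : ℂ).im|) ^ (3 / 4 : ℝ) ≤ (3 : ℝ) ^ (3 / 4 : ℝ) :=
            Real.rpow_le_rpow (by positivity) h3 (by norm_num)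
        _ ≤ (3 : ℝ) ^ (1 : ℝ) := Real.rpow_le_rpow_of_exponent_le (by norm_num) (by norm_num)
        _ = 3 := Real.rpow_one 3
    calc (riemannZetaZeroOrder (ρ : ℂ) : ℝ) / ‖w‖ ^ 2 * (2 + |(ρ : ℂ).im|) ^ (3 / 4 : ℝ)
        ≤ (riemannZetaZeroOrder (ρ : ℂ) : ℝ) / ‖w‖ ^ 2 * 3 := by gcongr
      _ = 3 * ((riemannZetaZeroOrder (ρ : ℂ) : ℝ) / ‖w‖ ^ (2 : ℝ)) := by rw [h2]; ring
      _ ≤ _ := by nlinarith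

/-- **Vanishing at every zero.** If a real combination of screw-kernel sections vanishes at every node, then
`R_z(ρ − ½) = Σ_j z_j (1 − (j+2)^{−(ρ−½)}) = 0` for EVERY non-trivial zero `ρ` (no hypothesis on the zeros). [new] -/
theorem R_eq_zero_of_nodes (n : ℕ) (z : Fin n → ℝ)
    (hz : ∀ i : ℕ, ∑ j : Fin n, zetaScrewKernel (Real.log ((i + 2 : ℕ) : ℝ))
        (Real.log (((j : ℕ) + 2 : ℕ) : ℝ)) * z j = 0)
    (ρ : ℂ) (hρ : ρ ∈ ZetaZeros.riemannZetaNontrivialZeros) :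
    ∑ j : Fin n, (z j : ℂ) * (1 - Complex.exp (-((ρ - 1 / 2) * (Real.log (((j : ℕ) + 2 : ℕ) : ℝ) : ℂ)))) = 0 := by
  -- the coefficients
  set a : ZetaZeros.riemannZetaNontrivialZeros → ℂ := fun ρ ↦
      (riemannZetaZeroOrder (ρ : ℂ) : ℂ) / ((ρ : ℂ) - 1 / 2) ^ 2 *
        ∑ j : Fin n, (z j : ℂ) * (1 - Complex.exp (-(((ρ : ℂ) - 1 / 2) * (Real.log (((j : ℕ) + 2 : ℕ) : ℝ) : ℂ))))
    with ha
  -- weighted summability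
  have hA : Summable fun ρ ↦ ‖a ρ‖ * (2 + |(ρ : ℂ).im|) ^ (3 / 4 : ℝ) := by
    set Zc : ℝ := ∑ j : Fin n, |z j| * (1 + Real.exp (Real.log (((j : ℕ) + 2 : ℕ) : ℝ) / 2)) with hZc
    have hZc0 : 0 ≤ Zc := Finset.sum_nonneg fun j _ ↦ by positivity
    have hS := ((ZetaZeroSum.summable_zeroOrder_div_norm_sub_half_rpow (σ := 5 / 4) (by norm_num)).add
      (ZetaZeroSum.summable_zeroOrder_div_norm_sub_half_rpow (σ := 2) (by norm_num))).mul_left (6 * Zc)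
    refine Summable.of_nonneg_of_le (fun ρ ↦ by positivity) (fun ρ ↦ ?_) hS
    have h1 : ‖a ρ‖ ≤ (riemannZetaZeroOrder (ρ : ℂ) : ℝ) / ‖(ρ : ℂ) - 1 / 2‖ ^ 2 * Zc := by
      rw [ha]; simp only
      rw [norm_mul, norm_weight]
      exact mul_le_mul_of_nonneg_left (norm_R_le n z (abs_re_sub_half_le ρ))
        (div_nonneg (by exact_mod_cast (zeroOrder_pos ρ).le) (by positivity))
    have h2 := weight_le ρ
    calc ‖a ρ‖ * (2 + |(ρ : ℂ).im|) ^ (3 / 4 : ℝ)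
        ≤ (riemannZetaZeroOrder (ρ : ℂ) : ℝ) / ‖(ρ : ℂ) - 1 / 2‖ ^ 2 * Zc * (2 + |(ρ : ℂ).im|) ^ (3 / 4 : ℝ) := by
          gcongr
      _ = Zc * ((riemannZetaZeroOrder (ρ : ℂ) : ℝ) / ‖(ρ : ℂ) - 1 / 2‖ ^ 2 * (2 + |(ρ : ℂ).im|) ^ (3 / 4 : ℝ)) := by
          ring
      _ ≤ Zc * (6 * ((riemannZetaZeroOrder (ρ : ℂ) : ℝ) / ‖(ρ : ℂ) - 1 / 2‖ ^ (5 / 4 : ℝ) +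
            (riemannZetaZeroOrder (ρ : ℂ) : ℝ) / ‖(ρ : ℂ) - 1 / 2‖ ^ (2 : ℝ))) := by gcongr
      _ = _ := by ring
  -- the node equations
  have hnode : ∀ m : ℕ, HasSum (fun ρ ↦ a ρ * ((m + 1 : ℕ) : ℂ) ^ ((ρ : ℂ) - 1 / 2)) (∑' ρ, a ρ) := by
    intro m
    have hm0 : (0 : ℝ) < ((m + 1 : ℕ) : ℝ) := by exact_mod_cast Nat.succ_pos m
    have hF := hasSum_nodeComb n z (Real.log ((m + 1 : ℕ) : ℝ))
    -- the node value vanishes: `m + 1 ≥ 2` from `hz`, `m + 1 = 1` from `Ψ(0) = 0`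
    have hzero : (∑ j : Fin n, zetaScrewKernel (Real.log ((m + 1 : ℕ) : ℝ)) (Real.log (((j : ℕ) + 2 : ℕ) : ℝ)) * z j) = 0 := by
      rcases Nat.eq_zero_or_pos m with hm | hm
      · subst hm
        refine Finset.sum_eq_zero fun j _ ↦ ?_
        simp [zetaScrewKernel_def, zetaScrew_zero]
      · obtain ⟨i, rfl⟩ : ∃ i, m = i + 1 := ⟨m - 1, by omega⟩
        have := hz i
        have e : ((i + 2 : ℕ) : ℝ) = ((i + 1 + 1 : ℕ) : ℝ) := by push_cast; ring
        rwa [e] at this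
    rw [hzero, Complex.ofReal_zero] at hF
    have h1 := (summable_coeff n z).hasSum
    have h2 := hF.add h1
    rw [zero_add] at h2
    refine h2.congr_fun fun ρ' ↦ ?_
    simp only [ha]
    rw [exp_mul_log_eq_cpow hm0]
    push_cast
    ring
  have h := coeff_eq_zero_of_nodes a (∑' ρ, a ρ) hA hnode ⟨ρ, hρ⟩
  simp only [ha] at h
  rcases mul_eq_zero.1 h with h1 | h1
  · exfalso
    refine div_ne_zero ?_ (pow_ne_zero 2 (sub_half_ne_zero ⟨ρ, hρ⟩)) h1
    exact_mod_cast (zeroOrder_pos ⟨ρ, hρ⟩).ne'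
  · exact h1

end Summit.RiemannHypothesis.RiemannHypothesis.Theorems.Splittings.ScrewNullComb

end
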